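import Mathlib.Analysis.Calculus.FDeriv.Bilinear
import Literature.Barriers.QuantumFields.NoClassicalGlueballs
import Literature.MathematicalPhysics.QuantumLattice.YangMillsClassicalBianchiProofs
import HarnessLib

/-!
# No classical glueballs: the Yang–Mills stress tensor (proofs, part 1)

Sibling proof file of `Literature/Barriers/QuantumFields/NoClassicalGlueballs.lean`, first of the
files discharging the named fact `ColemanNoClassicalGlueballs` (Coleman 1977). This file is the
pointwise (algebraic and differential) part of Coleman's §2: the energy–momentum tensor `θ^{μν}`
of a classical Yang–Mills field (Coleman (3)), its conservation `∂_μ θ^{μν} = 0` (4) from the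
field equations and the Bianchi identity, its tracelessness `θ^μ_μ = 0` (5), `θ^{00} = ½(E² + H²)`
(7) and the pointwise bound `|θ^{μν}| ≤ 5 θ^{00}` (a crude form of (9)).

## Setting

The coefficient algebra is a real normed algebra `𝔸` (bracket = commutator), as in the tree's
`YangMillsClassical`; the invariant inner product `tr` of the physics literature is abstracted as
a continuous bilinear form `B` on `𝔸` which is symmetric, restricts to the norm
(`B X X = ‖X‖²`) and is `ad`-invariant under a submodule `𝔤 ⊆ 𝔸` in which the connection takes
its values (`IsInvariantForm 𝔤 B`; for `𝔤 = 𝔲(N) ⊆ M_N(ℂ)` with the Frobenius norm,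
`B X Y = Re tr (Xᴴ Y)`, see the last proof file). Components refer to the coordinate frame
`unitVec μ` of `SpaceTime 3 = ℝ^{1+3}` and all indices are lower; `metricDiag μ = η^{μμ}`.

* `fieldStrength A μ ν x = F_{μν}(x) = F_A(x)(e_μ, e_ν)`;
* `stressTensor B A μ ν x = θ_{μν}(x) = −Σ_ρ η^{ρρ} B(F_{μρ}, F_{νρ}) + ¼ η_{μν} Σ_{κρ} η^{κκ}η^{ρρ} B(F_{κρ}, F_{κρ})`
  (Coleman (3) with both indices lowered, sign fixed by `θ₀₀ ≥ 0`).

## Results (all proved)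

* `stressTensor_conservation_algebra`: the index computation behind (4) — for families
  `F_{μν}`, `G_{αμν}` (think `G = D_α F_{μν}`) that are antisymmetric, satisfy the field equations
  `Σ_μ η^{μμ} G_{μμν} = 0` and the Bianchi identity, the combination that is `Σ_μ η^{μμ} ∂_μ θ_{μν}`
  vanishes;
* `fderiv_form_eq` : `∂_w B(f, g) = B(D_w f, g) + B(f, D_w g)` for `𝔤`-valued `A` (invariance);
* `stressTensor_conservation`: `Σ_μ η^{μμ} ∂_μ θ_{μν} = 0` for smooth `𝔤`-valued solutions of the
  Yang–Mills equations `IsMinkowskiYangMills` (Coleman (4));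
* `stressTensor_zero_zero`: `θ₀₀ = ymEnergyDensity` (Coleman (7)); `stressTensor_trace`:
  `θ₀₀ = Σ_j θ_{jj}` (Coleman (5)); `abs_stressTensor_le`: `|θ_{μν}| ≤ 5 θ₀₀` (cf. Coleman (9)).

## References

* S. Coleman, *There are no classical glueballs*, Commun. Math. Phys. 55 (1977) 113–116, §2
  (3)–(9) [Coleman1977].
* R. T. Glassey, W. A. Strauss, *Decay of classical Yang–Mills fields*, Commun. Math. Phys. 65
  (1979) 1–13, §3 (energy identity (e), momentum identity (p_j)) [GlasseyStrauss1979].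
-/

noncomputable section

open scoped ContDiff
open Filter Topology

namespace Literature.Barriers.QuantumFields

open Literature.MathematicalPhysics.QuantumLattice

variable {𝔸 : Type*} [NormedRing 𝔸] [NormedAlgebra ℝ 𝔸]

/-! ### Invariant positive forms on the coefficient algebra -/

/-- An **invariant positive form** for the gauge algebra `𝔤 ⊆ 𝔸`: a continuous real bilinear
form `B` on the coefficient algebra which is symmetric, restricts to the norm on the diagonal
(`B(X, X) = ‖X‖²`, so the Yang–Mills energy density `½ Σ ‖F‖²` is `½ Σ B(F, F)`), and is
`ad(𝔤)`-invariant: `B([a, X], Y) + B(X, [a, Y]) = 0` for `a ∈ 𝔤` — the abstract form of the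
invariant trace `−tr(XY)` on a compact Lie algebra (Coleman: "the c's are the structure constants
of a compact Lie group"). [cite: Coleman1977, §2 (1)–(3)] -/
structure IsInvariantForm (𝔤 : Submodule ℝ 𝔸) (B : 𝔸 →L[ℝ] 𝔸 →L[ℝ] ℝ) : Prop where
  symm : ∀ X Y : 𝔸, B X Y = B Y X
  apply_self : ∀ X : 𝔸, B X X = ‖X‖ ^ 2
  lie_apply_add : ∀ a ∈ 𝔤, ∀ X Y : 𝔸, B ⁅a, X⁆ Y + B X ⁅a, Y⁆ = 0

namespace IsInvariantForm

variable {𝔤 : Submodule ℝ 𝔸} {B : 𝔸 →L[ℝ] 𝔸 →L[ℝ] ℝ}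

/-- Cauchy–Schwarz in the crude form `2|B(X,Y)| ≤ ‖X‖² + ‖Y‖²` (from `0 ≤ B(X ± Y, X ± Y)`).
[folklore] -/
theorem two_mul_abs_le (hB : IsInvariantForm 𝔤 B) (X Y : 𝔸) :
    2 * |B X Y| ≤ ‖X‖ ^ 2 + ‖Y‖ ^ 2 := by
  have h1 : 0 ≤ B (X - Y) (X - Y) := by rw [hB.apply_self]; positivity
  have h2 : 0 ≤ B (X + Y) (X + Y) := by rw [hB.apply_self]; positivity
  simp only [map_sub, map_add, sub_apply, add_apply, hB.apply_self, hB.symm Y X] at h1 h2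
  have h3 : |B X Y| ≤ (‖X‖ ^ 2 + ‖Y‖ ^ 2) / 2 := abs_le.2 ⟨by linarith, by linarith⟩
  linarith

/-- `|B(X,Y)| ≤ ‖X‖² + ‖Y‖²` (weaker but convenient). [folklore] -/
theorem abs_le (hB : IsInvariantForm 𝔤 B) (X Y : 𝔸) : |B X Y| ≤ ‖X‖ ^ 2 + ‖Y‖ ^ 2 := by
  have := hB.two_mul_abs_le X Y
  have h0 : 0 ≤ |B X Y| := abs_nonneg _
  linarith

end IsInvariantForm

/-! ### The index computation behind `∂_μ θ^{μν} = 0` -/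

/-- `η^{μμ} η^{μμ} = 1`. [folklore] -/
theorem metricDiag_mul_self (μ : Fin 4) : metricDiag μ * metricDiag μ = 1 := by
  unfold metricDiag; split_ifs <;> norm_num

/-- `|η^{μμ}| = 1`. [folklore] -/
theorem abs_metricDiag (μ : Fin 4) : |metricDiag μ| = 1 := by
  unfold metricDiag; split_ifs <;> norm_num

/-- **The algebra of energy–momentum conservation.** Let `F_{μν}` be antisymmetric, let
`G_{αμν}` (the covariant derivatives `D_α F_{μν}`) be antisymmetric in `μν`, satisfy the
Yang–Mills equations `Σ_μ η^{μμ} G_{μμν} = 0` and the Bianchi identity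
`G_{μνρ} + G_{νρμ} + G_{ρμν} = 0`, and let `B` be a symmetric-in-use bilinear form. Then for every
`ν` the quantity `Σ_μ η^{μμ} [−Σ_ρ η^{ρρ}(B(G_{μμρ}, F_{νρ}) + B(F_{μρ}, G_{μνρ})) +
η_{μν} ¼ Σ_{κρ} η^{κκ}η^{ρρ} 2B(F_{κρ}, G_{μκρ})]` — which is `Σ_μ η^{μμ} ∂_μ θ_{μν}` once
`∂ B(X,Y) = B(DX, Y) + B(X, DY)` — vanishes (Coleman (4); Glassey–Strauss §3: "the twelve cubic
terms … all cancel"). [cite: Coleman1977, §2 (4)] -/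
theorem stressTensor_conservation_algebra (B : 𝔸 →L[ℝ] 𝔸 →L[ℝ] ℝ) (F : Fin 4 → Fin 4 → 𝔸)
    (G : Fin 4 → Fin 4 → Fin 4 → 𝔸) (hF : ∀ μ ν, F ν μ = -F μ ν)
    (hG : ∀ α μ ν, G α ν μ = -G α μ ν) (hYM : ∀ ν, ∑ μ, metricDiag μ • G μ μ ν = 0)
    (hBi : ∀ μ ν ρ, G μ ν ρ + G ν ρ μ + G ρ μ ν = 0) (ν : Fin 4) :
    ∑ μ, metricDiag μ *
      (-(∑ ρ, metricDiag ρ * (B (G μ μ ρ) (F ν ρ) + B (F μ ρ) (G μ ν ρ))) +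
        (if μ = ν then metricDiag μ else 0) *
          ((1 / 4) * ∑ κ, ∑ ρ, metricDiag κ * metricDiag ρ * (2 * B (F κ ρ) (G μ κ ρ)))) = 0 := by
  -- the Yang–Mills term
  have hT1 : ∀ ρ, ∑ μ, metricDiag μ * B (G μ μ ρ) (F ν ρ) = 0 := by
    intro ρ
    have h := congrArg (fun X : 𝔸 => B X (F ν ρ)) (hYM ρ)
    simpa only [map_sum, map_smul, sum_apply, FunLike.coe_smul, Pi.smul_apply,
      smul_eq_mul, map_zero, zero_apply] using h
  -- the quadratic term, symmetrised in `μρ`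
  set T : ℝ := ∑ μ, ∑ ρ, metricDiag μ * metricDiag ρ * B (F μ ρ) (G μ ν ρ) with hT
  have hT2 : T = ∑ μ, ∑ ρ, metricDiag μ * metricDiag ρ * B (F μ ρ) (G ρ μ ν) := by
    rw [hT, Finset.sum_comm]
    refine Finset.sum_congr rfl fun a _ => Finset.sum_congr rfl fun b _ => ?_
    rw [hF a b, hG b a ν, map_neg, map_neg, neg_apply, neg_neg, mul_comm (metricDiag b)]
  have hT3 : 2 * T = ∑ μ, ∑ ρ, metricDiag μ * metricDiag ρ * B (F μ ρ) (G ν μ ρ) := by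
    have h2 : 2 * T = T + T := two_mul T
    conv_lhs => rw [h2]
    conv_lhs => arg 2; rw [hT2]
    rw [hT, ← Finset.sum_add_distrib]
    refine Finset.sum_congr rfl fun μ _ => ?_
    rw [← Finset.sum_add_distrib]
    refine Finset.sum_congr rfl fun ρ _ => ?_
    have hb : G μ ν ρ + G ρ μ ν = G ν μ ρ := by
      have h0 := hBi μ ν ρ
      rw [hG ν μ ρ] at h0
      rw [← sub_eq_zero, ← h0]
      abel
    rw [← mul_add, ← map_add, hb]
  have hQ : ∑ κ, ∑ ρ, metricDiag κ * metricDiag ρ * (2 * B (F κ ρ) (G ν κ ρ)) = 2 * (2 * T) := by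
    rw [hT3, Finset.mul_sum]
    refine Finset.sum_congr rfl fun κ _ => ?_
    rw [Finset.mul_sum]
    refine Finset.sum_congr rfl fun ρ _ => ?_
    ring
  -- assemble
  have hsplit : ∀ μ, metricDiag μ *
      (-(∑ ρ, metricDiag ρ * (B (G μ μ ρ) (F ν ρ) + B (F μ ρ) (G μ ν ρ))) +
        (if μ = ν then metricDiag μ else 0) *
          ((1 / 4) * ∑ κ, ∑ ρ, metricDiag κ * metricDiag ρ * (2 * B (F κ ρ) (G μ κ ρ)))) =
      ∑ ρ, (-(metricDiag ρ * (metricDiag μ * B (G μ μ ρ) (F ν ρ))) -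
          metricDiag μ * metricDiag ρ * B (F μ ρ) (G μ ν ρ)) +
        (if μ = ν then
          (1 / 4) * ∑ κ, ∑ ρ, metricDiag κ * metricDiag ρ * (2 * B (F κ ρ) (G μ κ ρ)) else 0) := by
    intro μ
    have e1 : metricDiag μ *
        -(∑ ρ, metricDiag ρ * (B (G μ μ ρ) (F ν ρ) + B (F μ ρ) (G μ ν ρ))) =
        ∑ ρ, (-(metricDiag ρ * (metricDiag μ * B (G μ μ ρ) (F ν ρ))) -
          metricDiag μ * metricDiag ρ * B (F μ ρ) (G μ ν ρ)) := by
      rw [mul_neg, Finset.mul_sum, ← Finset.sum_neg_distrib]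
      exact Finset.sum_congr rfl fun ρ _ => by ring
    have e2 : ∀ Y : ℝ, metricDiag μ * ((if μ = ν then metricDiag μ else 0) * Y) =
        if μ = ν then Y else 0 := by
      intro Y
      split_ifs
      · rw [← mul_assoc, metricDiag_mul_self, one_mul]
      · rw [zero_mul, mul_zero]
    rw [mul_add, e1, e2]
  simp_rw [hsplit]
  rw [Finset.sum_add_distrib]
  simp only [Finset.sum_sub_distrib, Finset.sum_neg_distrib]
  have hA : ∑ μ, ∑ ρ, metricDiag ρ * (metricDiag μ * B (G μ μ ρ) (F ν ρ)) = 0 := by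
    rw [Finset.sum_comm]
    refine Finset.sum_eq_zero fun ρ _ => ?_
    rw [← Finset.mul_sum, hT1, mul_zero]
  have hC : ∑ μ, (if μ = ν then
      (1 / 4) * ∑ κ, ∑ ρ, metricDiag κ * metricDiag ρ * (2 * B (F κ ρ) (G μ κ ρ)) else 0) =
      (1 / 4) * ∑ κ, ∑ ρ, metricDiag κ * metricDiag ρ * (2 * B (F κ ρ) (G ν κ ρ)) := by
    simp only [Finset.sum_ite_eq', Finset.mem_univ, if_true]
  rw [hA, hC, hQ, ← hT]
  ring

/-! ### Covariant derivatives and invariant forms (any flat base) -/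

section Components

variable {E : Type*} [NormedAddCommGroup E] [InnerProductSpace ℝ E]

/-- `D_w(−f) = −D_w f` for the covariant derivative of the tree (`covDeriv`). [folklore] -/
theorem covDeriv_fun_neg (A : Connection E 𝔸) (f : E → 𝔸) (x w : E) :
    covDeriv A (fun y => -f y) x w = -covDeriv A f x w := by
  simp only [covDeriv, fderiv_fun_neg, neg_apply, Ring.lie_def]
  noncomm_ring

/-- **Leibniz rule with invariance.** For an `ad(𝔤)`-invariant form and a `𝔤`-valued connection,
the ordinary derivative of `B(f, g)` can be written with covariant derivatives:
`B(f, ∂_w g) + B(∂_w f, g) = B(D_w f, g) + B(f, D_w g)` (the commutator terms cancel).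
[cite: Coleman1977, §2 (3)–(4)] -/
theorem IsInvariantForm.form_fderiv_eq {𝔤 : Submodule ℝ 𝔸} {B : 𝔸 →L[ℝ] 𝔸 →L[ℝ] ℝ}
    (hB : IsInvariantForm 𝔤 B) {A : Connection E 𝔸} (h𝔤 : A.IsValuedIn 𝔤) (f g : E → 𝔸)
    (x w : E) :
    B (f x) (fderiv ℝ g x w) + B (fderiv ℝ f x w) (g x) =
      B (covDeriv A f x w) (g x) + B (f x) (covDeriv A g x w) := by
  simp only [covDeriv, map_add, add_apply]
  have := hB.lie_apply_add (A x w) (h𝔤 x w) (f x) (g x)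
  linarith

end Components

/-! ### Field strength components and the stress tensor on `ℝ^{1+3}` -/

section Minkowski

variable (B : 𝔸 →L[ℝ] 𝔸 →L[ℝ] ℝ) (A : Connection (SpaceTime 3) 𝔸)

/-- The field strength components `F_{μν}(x) = F_A(x)(e_μ, e_ν)` in the coordinate frame of
`ℝ^{1+3}` (Coleman (1)). [cite: Coleman1977, §2 (1)] -/
def fieldStrength (μ ν : Fin 4) (x : SpaceTime 3) : 𝔸 :=
  curvature A x (unitVec μ) (unitVec ν)

/-- `F_{νμ} = −F_{μν}`. [folklore] -/
theorem fieldStrength_antisymm (μ ν : Fin 4) (x : SpaceTime 3) :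
    fieldStrength A ν μ x = -fieldStrength A μ ν x :=
  curvature_antisymm A x _ _

/-- `F_{μμ} = 0`. [folklore] -/
@[simp]
theorem fieldStrength_self (μ : Fin 4) (x : SpaceTime 3) : fieldStrength A μ μ x = 0 :=
  curvature_self A x _

/-- `‖F_{νμ}‖ = ‖F_{μν}‖`. [folklore] -/
theorem norm_fieldStrength_comm (μ ν : Fin 4) (x : SpaceTime 3) :
    ‖fieldStrength A ν μ x‖ = ‖fieldStrength A μ ν x‖ := by
  rw [fieldStrength_antisymm, norm_neg]

variable {A}

/-- The components of a smooth connection's field strength are smooth. [folklore] -/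
theorem contDiff_fieldStrength (hA : IsSmoothConnection A) (μ ν : Fin 4) :
    ContDiff ℝ ∞ (fieldStrength A μ ν) :=
  contDiff_curvature hA _ _

/-- The components of a smooth connection's field strength are differentiable. [folklore] -/
theorem differentiable_fieldStrength (hA : IsSmoothConnection A) (μ ν : Fin 4) :
    Differentiable ℝ (fieldStrength A μ ν) :=
  (contDiff_fieldStrength hA μ ν).differentiable (by simp)

/-- `D_w F_{νμ} = −D_w F_{μν}`. [folklore] -/
theorem covDeriv_fieldStrength_antisymm (μ ν : Fin 4) (x w : SpaceTime 3) :
    covDeriv A (fieldStrength A ν μ) x w = -covDeriv A (fieldStrength A μ ν) x w := by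
  have h : fieldStrength A ν μ = fun y => -fieldStrength A μ ν y :=
    funext fun y => fieldStrength_antisymm A μ ν y
  rw [h, covDeriv_fun_neg]

/-- The Yang–Mills equations in components: `Σ_μ η^{μμ} D_μ F_{μν} = 0` (Coleman (2)).
[cite: Coleman1977, §2 (2)] -/
theorem sum_covDeriv_fieldStrength_eq_zero (hsol : IsMinkowskiYangMills A) (ν : Fin 4)
    (x : SpaceTime 3) : ∑ μ, metricDiag μ • covDeriv A (fieldStrength A μ ν) x (unitVec μ) = 0 :=
  hsol x (unitVec ν)

/-- The Bianchi identity in components: `D_μ F_{νρ} + D_ν F_{ρμ} + D_ρ F_{μν} = 0`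
(the tree's `covDeriv_curvature_cyclic_holds`). [folklore] -/
theorem covDeriv_fieldStrength_cyclic (hA : IsSmoothConnection A) (μ ν ρ : Fin 4)
    (x : SpaceTime 3) :
    covDeriv A (fieldStrength A ν ρ) x (unitVec μ) + covDeriv A (fieldStrength A ρ μ) x (unitVec ν) +
      covDeriv A (fieldStrength A μ ν) x (unitVec ρ) = 0 :=
  covDeriv_curvature_cyclic_holds A (hA.of_le (WithTop.coe_le_coe.mpr le_top)) x _ _ _

variable (A) in
/-- **The energy–momentum tensor** `θ_{μν}` of the classical Yang–Mills field (both indices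
lowered, `B` the invariant form):
`θ_{μν} = −Σ_ρ η^{ρρ} B(F_{μρ}, F_{νρ}) + ¼ η_{μν} Σ_{κρ} η^{κκ} η^{ρρ} B(F_{κρ}, F_{κρ})`
(Coleman (3), `θ^{μν} = −F^{μσa} F^{ν}{}_{σ}{}^{a} + ¼ g^{μν} F_{στ}^a F^{στa}`, with the sign
making `θ₀₀ = ½(E² + H²) ≥ 0`, (7)). [cite: Coleman1977, §2 (3), (7)] -/
def stressTensor (μ ν : Fin 4) (x : SpaceTime 3) : ℝ :=
  -(∑ ρ, metricDiag ρ * B (fieldStrength A μ ρ x) (fieldStrength A ν ρ x)) +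
    (if μ = ν then metricDiag μ else 0) *
      ((1 / 4) * ∑ κ, ∑ ρ, metricDiag κ * metricDiag ρ *
        B (fieldStrength A κ ρ x) (fieldStrength A κ ρ x))

variable {B}

/-- The quadratic quantities `B(F_{ab}, F_{cd})` of a smooth connection are smooth. [folklore] -/
theorem contDiff_form_fieldStrength (hA : IsSmoothConnection A) (a b c d : Fin 4) :
    ContDiff ℝ ∞ fun y => B (fieldStrength A a b y) (fieldStrength A c d y) :=
  (B.contDiff.comp (contDiff_fieldStrength hA a b)).clm_apply (contDiff_fieldStrength hA c d)

/-- The stress tensor of a smooth connection is smooth. [folklore] -/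
theorem contDiff_stressTensor (hA : IsSmoothConnection A) (μ ν : Fin 4) :
    ContDiff ℝ ∞ (stressTensor B A μ ν) := by
  unfold stressTensor
  exact (ContDiff.neg (ContDiff.sum fun ρ _ =>
    contDiff_const.mul (contDiff_form_fieldStrength hA μ ρ ν ρ))).add
    (contDiff_const.mul (contDiff_const.mul (ContDiff.sum fun κ _ => ContDiff.sum fun ρ _ =>
      contDiff_const.mul (contDiff_form_fieldStrength hA κ ρ κ ρ))))

/-- Derivative of the quadratic quantities `B(F_{ab}, F_{cd})` (bounded bilinear maps).
[folklore] -/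
theorem hasFDerivAt_form_fieldStrength (hA : IsSmoothConnection A) (a b c d : Fin 4)
    (x : SpaceTime 3) :
    HasFDerivAt (fun y => B (fieldStrength A a b y) (fieldStrength A c d y))
      (B.precompR (SpaceTime 3) (fieldStrength A a b x) (fderiv ℝ (fieldStrength A c d) x) +
        B.precompL (SpaceTime 3) (fderiv ℝ (fieldStrength A a b) x) (fieldStrength A c d x)) x :=
  B.hasFDerivAt_of_bilinear (differentiable_fieldStrength hA a b x).hasFDerivAt
    (differentiable_fieldStrength hA c d x).hasFDerivAt

/-- **Derivative of the stress tensor** along `w`, written with covariant derivatives of the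
field strength (Leibniz rule + `ad`-invariance of `B`):
`∂_w θ_{μν} = −Σ_ρ η^{ρρ}(B(D_wF_{μρ}, F_{νρ}) + B(F_{μρ}, D_wF_{νρ})) + ¼ η_{μν} Σ η η 2B(F, D_wF)`.
[cite: Coleman1977, §2 (3)–(4)] -/
theorem fderiv_stressTensor_apply {𝔤 : Submodule ℝ 𝔸} (hB : IsInvariantForm 𝔤 B)
    (h𝔤 : A.IsValuedIn 𝔤) (hA : IsSmoothConnection A) (μ ν : Fin 4) (x w : SpaceTime 3) :
    fderiv ℝ (stressTensor B A μ ν) x w =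
      -(∑ ρ, metricDiag ρ * (B (covDeriv A (fieldStrength A μ ρ) x w) (fieldStrength A ν ρ x) +
          B (fieldStrength A μ ρ x) (covDeriv A (fieldStrength A ν ρ) x w))) +
        (if μ = ν then metricDiag μ else 0) *
          ((1 / 4) * ∑ κ, ∑ ρ, metricDiag κ * metricDiag ρ *
            (2 * B (fieldStrength A κ ρ x) (covDeriv A (fieldStrength A κ ρ) x w))) := by
  have hL := hasFDerivAt_form_fieldStrength (B := B) hA
  have h : HasFDerivAt (stressTensor B A μ ν)
      (-(∑ ρ, metricDiag ρ •
          (B.precompR (SpaceTime 3) (fieldStrength A μ ρ x) (fderiv ℝ (fieldStrength A ν ρ) x) +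
            B.precompL (SpaceTime 3) (fderiv ℝ (fieldStrength A μ ρ) x) (fieldStrength A ν ρ x))) +
        (if μ = ν then metricDiag μ else 0) • ((1 / 4 : ℝ) • ∑ κ, ∑ ρ,
          (metricDiag κ * metricDiag ρ) •
            (B.precompR (SpaceTime 3) (fieldStrength A κ ρ x) (fderiv ℝ (fieldStrength A κ ρ) x) +
              B.precompL (SpaceTime 3) (fderiv ℝ (fieldStrength A κ ρ) x)
                (fieldStrength A κ ρ x)))) x := by
    unfold stressTensor
    exact ((HasFDerivAt.fun_sum fun ρ _ => (hL μ ρ ν ρ x).const_mul (metricDiag ρ)).fun_neg).fun_add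
      (((HasFDerivAt.fun_sum fun κ _ => HasFDerivAt.fun_sum fun ρ _ =>
        (hL κ ρ κ ρ x).const_mul (metricDiag κ * metricDiag ρ)).const_mul (1 / 4 : ℝ)).const_mul _)
  rw [h.fderiv]
  simp only [add_apply, neg_apply, sum_apply, smul_apply, smul_eq_mul,
    ContinuousLinearMap.precompR_apply, ContinuousLinearMap.precompL_apply,
    ContinuousLinearMap.compL_apply, ContinuousLinearMap.coe_comp, Function.comp_apply,
    hB.form_fderiv_eq h𝔤]
  congr 1
  congr 1
  congr 1
  refine Finset.sum_congr rfl fun κ _ => Finset.sum_congr rfl fun ρ _ => ?_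
  rw [hB.symm _ (fieldStrength A κ ρ x)]
  ring

/-- **Conservation of energy–momentum (Coleman (4)):** for a smooth `𝔤`-valued solution of the
Yang–Mills equations and an `ad(𝔤)`-invariant form, `Σ_μ η^{μμ} ∂_μ θ_{μν} = 0` for every `ν`,
i.e. `∂₀ θ_{0ν} = Σ_j ∂_j θ_{jν}`. [cite: Coleman1977, §2 (4)] -/
theorem stressTensor_conservation {𝔤 : Submodule ℝ 𝔸} (hB : IsInvariantForm 𝔤 B)
    (h𝔤 : A.IsValuedIn 𝔤) (hA : IsSmoothConnection A) (hsol : IsMinkowskiYangMills A)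
    (ν : Fin 4) (x : SpaceTime 3) :
    ∑ μ, metricDiag μ * fderiv ℝ (stressTensor B A μ ν) x (unitVec μ) = 0 := by
  simp_rw [fderiv_stressTensor_apply hB h𝔤 hA]
  exact stressTensor_conservation_algebra B (fun κ ρ => fieldStrength A κ ρ x)
    (fun α κ ρ => covDeriv A (fieldStrength A κ ρ) x (unitVec α))
    (fun κ ρ => fieldStrength_antisymm A κ ρ x)
    (fun α κ ρ => covDeriv_fieldStrength_antisymm κ ρ x (unitVec α))
    (fun ρ => sum_covDeriv_fieldStrength_eq_zero hsol ρ x)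
    (fun κ ρ σ => covDeriv_fieldStrength_cyclic hA κ ρ σ x) ν

/-- `∂₀ θ_{0ν} = Σ_j ∂_j θ_{jν}` (the conservation law solved for the time derivative).
[cite: Coleman1977, §2 (4)] -/
theorem fderiv_stressTensor_zero {𝔤 : Submodule ℝ 𝔸} (hB : IsInvariantForm 𝔤 B)
    (h𝔤 : A.IsValuedIn 𝔤) (hA : IsSmoothConnection A) (hsol : IsMinkowskiYangMills A)
    (ν : Fin 4) (x : SpaceTime 3) :
    fderiv ℝ (stressTensor B A 0 ν) x (unitVec 0) =
      ∑ j : Fin 3, fderiv ℝ (stressTensor B A j.succ ν) x (unitVec j.succ) := by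
  have h := stressTensor_conservation hB h𝔤 hA hsol ν x
  rw [Fin.sum_univ_succ] at h
  simp only [metricDiag_zero, one_mul, metricDiag_succ, neg_mul, Finset.sum_neg_distrib] at h
  linarith

/-! ### `θ₀₀`, the trace, and the pointwise bound -/

/-- `Σ_{κρ} ‖F_{κρ}‖² = 4 θ₀₀` (each `‖E_i‖²` twice, each `‖F_{ij}‖²` once). [folklore] -/
theorem sum_norm_sq_fieldStrength (x : SpaceTime 3) :
    ∑ κ, ∑ ρ, ‖fieldStrength A κ ρ x‖ ^ 2 = 4 * ymEnergyDensity A x := by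
  have hc : ∀ j : Fin 3, ‖fieldStrength A 0 j.succ x‖ = ‖fieldStrength A j.succ 0 x‖ := fun j =>
    norm_fieldStrength_comm A _ _ x
  simp only [Fin.sum_univ_succ (n := 3), fieldStrength_self, norm_zero, hc, Finset.sum_add_distrib]
  simp only [fieldStrength, ymEnergyDensity]
  ring

/-- **`θ₀₀` is the energy density** `½ Σ_i ‖F_{i0}‖² + ¼ Σ_{ij} ‖F_{ij}‖²` (Coleman (7)).
[cite: Coleman1977, §2 (7)] -/
theorem stressTensor_zero_zero {𝔤 : Submodule ℝ 𝔸} (hB : IsInvariantForm 𝔤 B) (x : SpaceTime 3) :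
    stressTensor B A 0 0 x = ymEnergyDensity A x := by
  have hc : ∀ j : Fin 3, ‖fieldStrength A 0 j.succ x‖ = ‖fieldStrength A j.succ 0 x‖ := fun j =>
    norm_fieldStrength_comm A _ _ x
  simp only [stressTensor, hB.apply_self, if_true, Fin.sum_univ_succ (n := 3), metricDiag_zero,
    metricDiag_succ, fieldStrength_self, norm_zero, hc, one_mul, mul_one, neg_mul, mul_neg, neg_neg,
    Finset.sum_neg_distrib, Finset.sum_add_distrib]
  simp only [fieldStrength, ymEnergyDensity]
  ring

/-- **Tracelessness (Coleman (5))** in the form used: `θ₀₀ = Σ_j θ_{jj}`. [cite: Coleman1977, §2 (5)] -/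
theorem stressTensor_trace (x : SpaceTime 3) :
    stressTensor B A 0 0 x = ∑ j : Fin 3, stressTensor B A j.succ j.succ x := by
  have h : ∑ μ, metricDiag μ * stressTensor B A μ μ x = 0 := by
    set Q := ∑ κ, ∑ ρ, metricDiag κ * metricDiag ρ *
      B (fieldStrength A κ ρ x) (fieldStrength A κ ρ x) with hQ
    have h1 : ∀ μ, metricDiag μ * stressTensor B A μ μ x =
        -(∑ ρ, metricDiag μ * metricDiag ρ * B (fieldStrength A μ ρ x) (fieldStrength A μ ρ x)) +
          (1 / 4) * Q := by
      intro μ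
      simp only [stressTensor, if_true, ← hQ]
      rw [mul_add, mul_neg, Finset.mul_sum, ← mul_assoc (metricDiag μ) (metricDiag μ),
        metricDiag_mul_self, one_mul]
      congr 1
      congr 1
      exact Finset.sum_congr rfl fun ρ _ => by ring
    simp_rw [h1]
    rw [Finset.sum_add_distrib, Finset.sum_neg_distrib, Finset.sum_const, Finset.card_univ,
      Fintype.card_fin, ← hQ]
    simp only [nsmul_eq_mul, Nat.cast_ofNat]
    ring
  rw [Fin.sum_univ_succ] at h
  simp only [metricDiag_zero, one_mul, metricDiag_succ, neg_mul, Finset.sum_neg_distrib] at h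
  linarith

/-- **Pointwise bound** `|θ_{μν}| ≤ 5 θ₀₀` (crude constant; Coleman (9) is the sharp
`|eⁱθ_{0i}| ≤ θ₀₀`). [cite: Coleman1977, §2 (9)] -/
theorem abs_stressTensor_le {𝔤 : Submodule ℝ 𝔸} (hB : IsInvariantForm 𝔤 B) (μ ν : Fin 4)
    (x : SpaceTime 3) : |stressTensor B A μ ν x| ≤ 5 * ymEnergyDensity A x := by
  have hN := sum_norm_sq_fieldStrength (A := A) x
  set N := ∑ κ, ∑ ρ, ‖fieldStrength A κ ρ x‖ ^ 2 with hNdef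
  have hrow : ∀ μ, ∑ ρ, ‖fieldStrength A μ ρ x‖ ^ 2 ≤ N := fun μ =>
    Finset.single_le_sum (f := fun κ => ∑ ρ, ‖fieldStrength A κ ρ x‖ ^ 2)
      (fun κ _ => Finset.sum_nonneg fun ρ _ => by positivity) (Finset.mem_univ μ)
  have h1 : |∑ ρ, metricDiag ρ * B (fieldStrength A μ ρ x) (fieldStrength A ν ρ x)| ≤ N := by
    calc |∑ ρ, metricDiag ρ * B (fieldStrength A μ ρ x) (fieldStrength A ν ρ x)|
        ≤ ∑ ρ, |metricDiag ρ * B (fieldStrength A μ ρ x) (fieldStrength A ν ρ x)| :=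
          Finset.abs_sum_le_sum_abs _ _
      _ ≤ ∑ ρ, (‖fieldStrength A μ ρ x‖ ^ 2 + ‖fieldStrength A ν ρ x‖ ^ 2) / 2 := by
          refine Finset.sum_le_sum fun ρ _ => ?_
          rw [abs_mul, abs_metricDiag, one_mul]
          have := hB.two_mul_abs_le (fieldStrength A μ ρ x) (fieldStrength A ν ρ x)
          linarith
      _ = ((∑ ρ, ‖fieldStrength A μ ρ x‖ ^ 2) + ∑ ρ, ‖fieldStrength A ν ρ x‖ ^ 2) / 2 := by
          rw [← Finset.sum_add_distrib, Finset.sum_div]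
      _ ≤ N := by linarith [hrow μ, hrow ν]
  have h2 : |∑ κ, ∑ ρ, metricDiag κ * metricDiag ρ *
      B (fieldStrength A κ ρ x) (fieldStrength A κ ρ x)| ≤ N := by
    calc |∑ κ, ∑ ρ, metricDiag κ * metricDiag ρ * B (fieldStrength A κ ρ x) (fieldStrength A κ ρ x)|
        ≤ ∑ κ, |∑ ρ, metricDiag κ * metricDiag ρ *
            B (fieldStrength A κ ρ x) (fieldStrength A κ ρ x)| := Finset.abs_sum_le_sum_abs _ _
      _ ≤ ∑ κ, ∑ ρ, |metricDiag κ * metricDiag ρ *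
            B (fieldStrength A κ ρ x) (fieldStrength A κ ρ x)| :=
          Finset.sum_le_sum fun κ _ => Finset.abs_sum_le_sum_abs _ _
      _ = N := by
          refine Finset.sum_congr rfl fun κ _ => Finset.sum_congr rfl fun ρ _ => ?_
          rw [abs_mul, abs_mul, abs_metricDiag, abs_metricDiag, one_mul, one_mul, hB.apply_self,
            abs_of_nonneg (by positivity)]
  have h3 : |(if μ = ν then metricDiag μ else 0)| ≤ 1 := by
    split_ifs
    · rw [abs_metricDiag]
    · simp
  have hN0 : 0 ≤ N := Finset.sum_nonneg fun κ _ => Finset.sum_nonneg fun ρ _ => by positivity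
  unfold stressTensor
  calc |-(∑ ρ, metricDiag ρ * B (fieldStrength A μ ρ x) (fieldStrength A ν ρ x)) +
        (if μ = ν then metricDiag μ else 0) * ((1 / 4) * ∑ κ, ∑ ρ, metricDiag κ * metricDiag ρ *
          B (fieldStrength A κ ρ x) (fieldStrength A κ ρ x))|
      ≤ |∑ ρ, metricDiag ρ * B (fieldStrength A μ ρ x) (fieldStrength A ν ρ x)| +
        |(if μ = ν then metricDiag μ else 0)| * ((1 / 4) * |∑ κ, ∑ ρ, metricDiag κ * metricDiag ρ *
          B (fieldStrength A κ ρ x) (fieldStrength A κ ρ x)|) := by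
          refine (abs_add_le _ _).trans ?_
          rw [abs_neg, abs_mul, abs_mul, abs_of_pos (by norm_num : (0 : ℝ) < 1 / 4)]
    _ ≤ N + 1 * ((1 / 4) * N) := by gcongr
    _ = 5 * ymEnergyDensity A x := by rw [hN]; ring

end Minkowski

end Literature.Barriers.QuantumFields
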